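import Literature.Probability.RandomPlanarGeometry.RestrictionMeasuresFiveEighthsOneSided
import Literature.Probability.RandomPlanarGeometry.OneSidedExcursionCloudMeasure
import HarnessLib

/-!
# [LSW] p. 5 result 2, uniqueness (`LawlerSchrammWerner2003_unique`): reduction to the martingale leaf plus one positivity input

Proof-only glue (no definition, no named fact) for the named fact
`Literature.Probability.RandomPlanarGeometry.LawlerSchrammWerner2003_unique`
(`ConformalRestrictionProofs`), after

* G. F. Lawler, O. Schramm, W. Werner, *Conformal restriction: the chordal case*, J. Amer. Math.
  Soc. **16** (2003) 917–955, arXiv:math/0209343 (**[LSW]**), p. 5 result 2: "The only measure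
  `P_α` that is supported on simple curves is `P_{5/8}`. It is the law of chordal SLE_{8/3}" —
  in the paper the conjunction of Lemma 3.2 (p. 10), Prop. 3.3 (pp. 10–13), Thm. 7.3 (p. 29)
  and Cor. 8.6 (pp. 37–38);
* G. F. Lawler, *Conformally Invariant Processes in the Plane*, AMS (2005) (**[Law05]**), §9.2
  Prop. 9.13 and the proof of Cor. 9.11 (pp. 219–220) (the Poissonian construction of `P⁺_β`
  and "`q(α) ∈ (0, 1)`").

State of the tree (2026-08-15). The uniqueness statement is `LawlerSchrammWerner2003_unique_of_five_eighths h58`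
(`ConformalRestrictionThreeLeaves`: pull-back to `ℍ`, Prop. 3.3 with the slit Loewner theorem,
Lemma 3.2 — all proved), `h58 : IsRestrictionMeasure.eq_five_eighths_of_outer_simple` being the
sentence "a two-sided restriction measure carried by simple curves has exponent `5/8`". Since the
six-leaf reduction of `ConformalRestrictionUniqueLeaves` the tree discharged the symmetry sentence
of p. 38 (`measure_I_notMem_leftFilling_sle_eq_half_holds`), reduced the comparison sentence of
p. 38 to the small-exponent positivity "`P⁺_β{i ∈ K} > 0` for arbitrarily small `β`"
(`RestrictionMeasuresFiveEighthsPositivity`, [Law05] Cor. 9.11), obtained that positivity from any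
two-sided `P_1` with interior points by [Law05] Prop. 9.13 (`ExcursionCloud.small_exponent_positivity`,
`OneSidedExcursionCloudMeasure`), and replaced the §7 half (`α > 5/8`) by a one-sided argument
needing only the INTERIOR form of that positivity (`RestrictionMeasuresFiveEighthsOneSided`).
Accordingly this file records `LawlerSchrammWerner2003_unique` from the two current minimal
leaf sets (everything else PROVED in the tree):

* `Literature.Probability.RandomPlanarGeometry.LawlerSchrammWerner2003_unique_of_martingale_of_intPos` —
  from the one-sided restriction martingale of [LSW] Lemmas 8.9–8.10
  (`SLEKappaRho.exists_isOneSidedMartingale`) and the small-`β` interior positivity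
  "for every `ε > 0` some `P⁺_β`, `0 < β ≤ ε`, makes `i` an interior point of `K` with positive
  probability" (no §7, no Brownian bubbles);
* `Literature.Probability.RandomPlanarGeometry.LawlerSchrammWerner2003_unique_of_four_leaves` —
  from the same martingale and the three §7 leaves of [LSW] Thm. 7.3 (a Brownian bubble measure
  with interior points `exists_isBrownianBubbleMeasure_ae_interior_nonempty`, `Ξ(κ) ∈ Ω` a.s.
  `SLEBubbles.ae_mem_restrictionConfigs`, Theorem 6.5 `SLEBubbles.lintegral_poissonAvoidance_eq_rpow`):
  the §7 leaves give a `P_1` with interior points (`exists_isRestrictionMeasure_ae_interior_nonempty_of_three_leaves`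
  at `α = 1`), hence the small-`β` positivity by the Poissonian cloud of hung samples, hence
  (with the martingale) Cor. 8.6 and the `α > 5/8` half
  (`IsRestrictionMeasure.eq_five_eighths_of_outer_simple_of_four_leaves_of_pos`).

So the discharge `LawlerSchrammWerner2003_unique_holds` is either theorem applied to the `_holds`
of its leaves once they exist (equivalently `LawlerSchrammWerner2003_unique_of_five_eighths
IsRestrictionMeasure.eq_five_eighths_of_outer_simple_holds`).

Mathlib: `one_half_lt_one`-type numerals only. Tree: the assemblies quoted above.

## References

* [LSW] p. 5 result 2; Lemma 3.2, Prop. 3.3 (pp. 10–13), Thm. 6.5, Thm. 7.3 (p. 29), Thm. 8.4,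
  Cor. 8.6 (pp. 37–38), §8.1–8.2. [LawlerSchrammWerner2003Restriction]
* [Law05] §9.2 Prop. 9.13, Cor. 9.11 (pp. 219–220). [Lawler2005]
-/

noncomputable section

open MeasureTheory

namespace Literature.Probability.RandomPlanarGeometry

/-- **[LSW] p. 5 result 2 (uniqueness of the restriction measure on simple curves) from TWO
inputs**: the one-sided restriction martingale of Lemmas 8.9–8.10 (`hM`: Thm. 8.4, hence all
`P⁺_β` and, with the positivity, Cor. 8.6) and the small-`β` interior positivity (`hint`), through
`IsRestrictionMeasure.eq_five_eighths_of_outer_simple_of_martingale_of_intPos` (no §7) and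
`LawlerSchrammWerner2003_unique_of_five_eighths` (Lemma 3.2, Prop. 3.3, slit Loewner theorem).
[cite: LawlerSchrammWerner2003Restriction, p. 5 result 2; Lemma 3.2 (p. 10), Prop. 3.3 (pp. 10–13), Thm. 8.4 (p. 37), Cor. 8.6 (pp. 37–38), §8.1–8.2] -/
theorem LawlerSchrammWerner2003_unique_of_martingale_of_intPos
    (hM : SLEKappaRho.exists_isOneSidedMartingale)
    (hint : ∀ ε : ℝ, 0 < ε → ∃ (β : ℝ) (Q : Measure RightConfig), 0 < β ∧ β ≤ ε ∧
      IsRightRestrictionMeasure β Q ∧ Q {K : RightConfig | Complex.I ∈ interior (K : Set ℂ)} ≠ 0) :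
    LawlerSchrammWerner2003_unique :=
  LawlerSchrammWerner2003_unique_of_five_eighths
    (IsRestrictionMeasure.eq_five_eighths_of_outer_simple_of_martingale_of_intPos hM hint)

/-- **[LSW] p. 5 result 2 (uniqueness) from FOUR leaves**: the martingale of Lemmas 8.9–8.10
(`hM`) and the three §7 leaves of Thm. 7.3 (`hμex`, `hcfg`, `h65`). The §7 leaves give a
two-sided `P_1` almost every sample of which has an interior point
(`exists_isRestrictionMeasure_ae_interior_nonempty_of_three_leaves` at `α = 1 > 5/8`); the
Poissonian cloud of hung `P_1`-samples ([Law05] Prop. 9.13) then gives, for every `β > 0`, a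
`P⁺_β` charging `i` (`ExcursionCloud.small_exponent_positivity`), which is the positivity input of
`IsRestrictionMeasure.eq_five_eighths_of_outer_simple_of_four_leaves_of_pos` (Cor. 8.6 by
[Law05] Cor. 9.11, the `α > 5/8` half by Thm. 7.3).
[cite: LawlerSchrammWerner2003Restriction, p. 5 result 2; Lemma 3.2 (p. 10), Prop. 3.3 (pp. 10–13), Thm. 7.3 (p. 29), Cor. 8.6 (pp. 37–38)] -/
theorem LawlerSchrammWerner2003_unique_of_four_leaves
    (hM : SLEKappaRho.exists_isOneSidedMartingale)
    (hμex : exists_isBrownianBubbleMeasure_ae_interior_nonempty)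
    (hcfg : SLEBubbles.ae_mem_restrictionConfigs)
    (h65 : SLEBubbles.lintegral_poissonAvoidance_eq_rpow) :
    LawlerSchrammWerner2003_unique := by
  -- a two-sided `P_1` with interior points, from the §7 leaves (Thm. 7.3 at `α = 1`)
  have h1 : ∃ P : Measure RestrictionConfig, IsRestrictionMeasure 1 P ∧
      ∀ᵐ K : RestrictionConfig ∂P, (interior (K : Set ℂ)).Nonempty :=
    exists_isRestrictionMeasure_ae_interior_nonempty_of_three_leaves hμex hcfg h65 1 (by norm_num)
  exact LawlerSchrammWerner2003_unique_of_five_eighths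
    (IsRestrictionMeasure.eq_five_eighths_of_outer_simple_of_four_leaves_of_pos hM
      (ExcursionCloud.small_exponent_positivity h1) hμex hcfg h65)

end Literature.Probability.RandomPlanarGeometry

end
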